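import Summits.ResolutionOfSingularities.ResolutionOfSingularities.Theorems.WeightedInvariantIotaOrderStratDimTwo
import Summits.ResolutionOfSingularities.ResolutionOfSingularities.Theorems.WeightedInvariantWeightedChartPrimaryLocal
import Summits.ResolutionOfSingularities.ResolutionOfSingularities.Theorems.WeightedInvariantRegularSubschemeCentre
import Summits.ResolutionOfSingularities.ResolutionOfSingularities.Theorems.WeightedInvariantContactCentreFiltration
import Literature.AlgebraicGeometry.Resolution.CobordantBlowupExtReesBridge
import HarnessLib

/-!
# Equimultiplicity of a hypersurface germ along a PERMISSIBLE centre: `ord_{S_P}(f) = ord_S(f) ↔ f ∈ P^ν`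
# — door `HypersurfaceCentreConstruction` (stmt-ResolutionOfSingularities-19897), route `WeightedInvariant`, rung P3 input

[OURS · L1 W4.3 · cell `res-hironaka`, HUMAN RULING D-0089] Helper file `--supports stmt-ResolutionOfSingularities-19897`
(res-type-078 g13, OFFER (P3-ι) «IOTA3-INPUT» 2026-08-27T10:18Z, kernel deliverable (B)).  Replaces the role of NO
printed item; NOT a statement of the manuscript under review [claim: Hironaka2017, status: under-review].  AI work,
weaker than expert review.  Pure commutative algebra over the tree; no named facts; def-free.

WHY.  The position-dimension rung ladder of the key `LocalWeightedDropEFT4S` (res-L1-w43-plan-1 `CRUX-PLAN.md` §v7.2)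
reached P2 (p521487): at positions of Krull dimension `≤ 2` the (strat) prime of the order function is either a
height-one prime `(g)` — `f = v·g^ν` of MONOMIAL TYPE (`…IotaOrderMonomialType`, `…IotaOrderStratDimTwo`, res-type-073)
— or `𝔪`.  At rung P3 (surfaces in smooth threefolds) the new (strat) centres are HEIGHT-TWO primes `P` with `S ⧸ P`
regular («cylinder positions», ORDER (o28) of the cell: `J(R,f,m) := (jContact R_P f m).comap`), and every candidate
`ι₃` whose first letter is the order `iotaOrd` needs, at such a centre, the classical equimultiplicity criterion that
this file proves in EVERY Krull dimension and EVERY height: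

* `pow_isPrimary_and_radical_eq` — in a regular local ring `S`, the powers `P^n` (`n ≥ 1`) of a prime `P` with
  `S ⧸ P` regular are `P`-PRIMARY (the tree's `exists_span_eq_of_isRegularLocalRing_quotient`: `P` is generated by
  part of a regular system of parameters, + `isPrimary_span_weightedMonomials_of_linearIndependent_toCotangent` at
  weights `1`, + `weightedMonomialIdeal_one_eq_pow`); hence `P^n S_𝔭 ∩ S = P^n` for every prime `𝔭 ⊇ P`
  (`comap_map_pow_eq`) — the symbolic powers of a permissible centre are its ordinary powers;
* `iotaOrd_localization_eq_iff_mem_pow` — **for `f` of order `ν` (`iotaOrd S f = ν`):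
  `iotaOrd (S_P) f = iotaOrd S f ↔ f ∈ P ^ ν`** (→: `f ∈ 𝔪_{S_P}^ν ∩ S = P^{(ν)} = P^ν`; ←: `f ∈ P^ν ⊆ 𝔭^ν` gives
  `ν ≤ ord_{S_𝔭} f`, and (c7) `iotaOrd_generizationMonotone` gives `≤`), with the one-sided forms
  `mem_pow_of_iotaOrd_localization_eq` / `iotaOrd_localization_eq_of_mem_pow` (the latter at EVERY prime `𝔭 ⊇ P`:
  the «`P ≤ 𝔭 →`» half of the (strat) iff of `CanonicalGameClause` for any `ι` beginning with `iotaOrd`);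
* `adm_of_mem_pow` — the (adm) conjunct along `V(P)`: `f ∈ P^ν`, `ν ≥ 2`, `P ≤ Q` ⇒ `f ∈ 𝔪_{S_Q}²` (any ring);
* `exists_eq_unit_mul_pow_of_iotaOrd_localization_eq_of_height_eq_one` — res-type-073's core lemma of
  `…IotaOrderStratDimTwo` with its only use of `dim S ≤ 2` (forcing the prime to have height one) turned into the
  hypothesis `𝔭.height = 1`: in EVERY Krull dimension an equimultiple height-one prime forces MONOMIAL TYPE
  (`IsMonomialType f`, (o24-D) vocabulary) and is `(g)`; contrapositive `two_le_height_of_iotaOrd_localization_eq`: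
  off the monomial type every equimultiple prime `≠ ⊥` has height `≥ 2` — at a position of Krull dimension `3`
  the equal-order locus through the closed point is `{𝔪}` together with finitely many height-two primes, which is the
  case split every `ι₃` design starts from (res-type-073's specimen `…IotaOrderNotCanonical`: two such primes through
  the origin of `z² + x³y³`).

## References (tree / classical; nothing of the manuscript under review is used)

* H. Matsumura, *Commutative Ring Theory*, CUP 1986, Thms. 14.2, 16.2 (regular sequences, quasi-regularity), Thm. 20.3
  (regular local rings are UFDs). [Matsumura1987]
* O. Zariski, P. Samuel, *Commutative Algebra* II, Ch. VIII §1 (the order valuation of a regular local ring).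
  [ZariskiSamuel1960]
* res-L1-w43-plan-1, `CRUX-PLAN.md` §v7.2 (rung ladder), CHAIN w43 v4.18 §(2) (rung P3; OURS, AI planning).
-/

noncomputable section

open IsLocalRing Literature.AlgebraicGeometry.Resolution

set_option linter.dupNamespace false -- mandated namespace of this single-conjunct summit

namespace Summit.ResolutionOfSingularities.ResolutionOfSingularities.Cruxes.HypersurfaceCentreConstruction.LocalEngine

namespace EquimultipleCentre

open Summit.ResolutionOfSingularities.ResolutionOfSingularities.Theorems

variable {S : Type} [CommRing S]

/-! ## 1. Powers of a permissible prime are primary -/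

/-- The all-weights-one weighted pieces of a family `x` are the powers of the ideal it generates, in the
`weightedMonomials` (finsupp-exponent) form consumed by the primary-ness lemma of the tree. [folklore] -/
theorem span_weightedMonomials_const_one_eq_pow {c : ℕ} (x : Fin c → S) (n : ℕ) :
    Ideal.span (weightedMonomials x (fun _ => (1 : ℕ)) n) = Ideal.span (Set.range x) ^ n := by
  rw [← weightedFiltration_ideal, ← weightedMonomialIdeal_eq_weightedFiltration_ideal,
    Theorems.weightedMonomialIdeal_one_eq_pow]

/-- **Powers of a permissible prime are primary.**  In a regular local ring `S`, for a prime `P` with `S ⧸ P` regular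
and `n ≥ 1`, the power `P ^ n` is a primary ideal with radical `P` (`P` is generated by part of a regular system of
parameters, whose weighted pieces — here with all weights `1` — are primary). [cite: Matsumura1987, Thm. 14.2 and Thm. 16.2] -/
theorem pow_isPrimary_and_radical_eq [IsRegularLocalRing S] (P : Ideal S) [P.IsPrime]
    [IsRegularLocalRing (S ⧸ P)] {n : ℕ} (hn : 1 ≤ n) : (P ^ n).IsPrimary ∧ (P ^ n).radical = P := by
  have hPm : P ≤ maximalIdeal S := IsLocalRing.le_maximalIdeal (Ideal.IsPrime.ne_top ‹_›)
  obtain ⟨c, x, _hxP, hspan, hli⟩ :=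
    exists_span_eq_of_isRegularLocalRing_quotient hPm (P : Set S) (Ideal.span_eq P)
  have hx : ∀ i, x i ∈ maximalIdeal S := fun i => hPm (hspan.le (Ideal.subset_span ⟨i, rfl⟩))
  have key := isPrimary_span_weightedMonomials_of_linearIndependent_toCotangent x hx hli (fun _ => 1)
    (fun _ => Nat.one_pos) hn
  rwa [span_weightedMonomials_const_one_eq_pow, hspan] at key

/-- **Symbolic powers of a permissible centre are ordinary powers**: for primes `P ≤ 𝔭` of a regular local ring `S`
with `S ⧸ P` regular, `P^n S_𝔭 ∩ S = P^n`. [cite: Matsumura1987, Thm. 14.2 and Thm. 16.2] -/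
theorem comap_map_pow_eq [IsRegularLocalRing S] (P : Ideal S) [P.IsPrime] [IsRegularLocalRing (S ⧸ P)]
    (𝔭 : Ideal S) [𝔭.IsPrime] (hle : P ≤ 𝔭) (n : ℕ) :
    ((P ^ n).map (algebraMap S (Localization.AtPrime 𝔭))).comap (algebraMap S (Localization.AtPrime 𝔭)) =
      P ^ n := by
  rcases Nat.eq_zero_or_pos n with rfl | hn
  · rw [pow_zero, Ideal.one_eq_top, Ideal.map_top, Ideal.comap_top]
  obtain ⟨hprim, hrad⟩ := pow_isPrimary_and_radical_eq P hn
  have hdisj : Disjoint (𝔭.primeCompl : Set S) (↑(P ^ n) : Set S) := by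
    refine Set.disjoint_left.mpr fun s hs hsP => hs (hle ?_)
    have h : s ∈ (P ^ n).radical := Ideal.le_radical hsP
    rwa [hrad] at h
  have h := IsLocalization.under_map_of_isPrimary_disjoint 𝔭.primeCompl (Localization.AtPrime 𝔭) hprim hdisj
  rwa [Ideal.under_def] at h

/-! ## 2. Equimultiplicity along a permissible centre -/

/-- **`ord_{S_P}(f) = ord_S(f)` forces `f ∈ P^ν`** (`ν = ord_S f`) at a prime `P` with regular quotient of a regular local
ring: `f ∈ 𝔪_{S_P}^ν ∩ S = P^ν S_P ∩ S = P^ν`. [cite: ZariskiSamuel1960, Ch. VIII §1 Thm. 1] -/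
theorem mem_pow_of_iotaOrd_localization_eq [IsRegularLocalRing S] (P : Ideal S) [P.IsPrime]
    [IsRegularLocalRing (S ⧸ P)] {f : S} {ν : ℕ} (hν : iotaOrd S f = ν)
    (heq : iotaOrd (Localization.AtPrime P) (algebraMap S (Localization.AtPrime P) f) = iotaOrd S f) :
    f ∈ P ^ ν := by
  have h1 : (ν : Ordinal) ≤ iotaOrd (Localization.AtPrime P) (algebraMap S (Localization.AtPrime P) f) := by
    rw [heq, hν]
  rw [natCast_le_iotaOrd_iff, ← Localization.AtPrime.map_eq_maximalIdeal, ← Ideal.map_pow] at h1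
  have h2 : f ∈ ((P ^ ν).map (algebraMap S (Localization.AtPrime P))).comap
      (algebraMap S (Localization.AtPrime P)) := Ideal.mem_comap.mpr h1
  rwa [comap_map_pow_eq P P le_rfl] at h2

/-- **`f ∈ P^ν` keeps the order along `V(P)`**: for ANY ideal `P` and prime `𝔭 ⊇ P` of a regular local ring,
`f ∈ P^ν` with `ν = ord_S f` gives `ord_{S_𝔭}(f) = ord_S(f)` (`≥` from `f ∈ 𝔭^ν`, `≤` is (c7)
`iotaOrd_generizationMonotone`).  This is the «`P ≤ 𝔭 →`» half of the (strat) conjunct of `CanonicalGameClause`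
for every `ι` beginning with `iotaOrd`. [cite: ZariskiSamuel1960, Ch. VIII §1 Thm. 1] -/
theorem iotaOrd_localization_eq_of_mem_pow [IsRegularLocalRing S] {P : Ideal S} (𝔭 : Ideal S) [𝔭.IsPrime]
    (hle : P ≤ 𝔭) {f : S} {ν : ℕ} (hν : iotaOrd S f = ν) (hf : f ∈ P ^ ν) :
    iotaOrd (Localization.AtPrime 𝔭) (algebraMap S (Localization.AtPrime 𝔭) f) = iotaOrd S f := by
  refine le_antisymm (iotaOrd_generization_le_of_isRegularLocalRing S 𝔭 (Localization.AtPrime 𝔭) f) ?_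
  rw [hν]
  exact IotaOrderStrat.natCast_le_iotaOrd_localization_of_mem_pow 𝔭 (Ideal.pow_right_mono hle ν hf)

/-- **Equimultiplicity along a permissible centre.**  Let `S` be a regular local ring, `P` a prime with `S ⧸ P`
regular, and `f ∈ S` of order `ν` (`iotaOrd S f = ν`).  Then the order of `f` at the generic point of `V(P)` equals
its order at the closed point IFF `f ∈ P ^ ν`. [cite: ZariskiSamuel1960, Ch. VIII §1 Thm. 1] -/
theorem iotaOrd_localization_eq_iff_mem_pow [IsRegularLocalRing S] (P : Ideal S) [P.IsPrime]
    [IsRegularLocalRing (S ⧸ P)] {f : S} {ν : ℕ} (hν : iotaOrd S f = ν) :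
    iotaOrd (Localization.AtPrime P) (algebraMap S (Localization.AtPrime P) f) = iotaOrd S f ↔ f ∈ P ^ ν :=
  ⟨mem_pow_of_iotaOrd_localization_eq P hν, iotaOrd_localization_eq_of_mem_pow P le_rfl hν⟩

/-- **Equimultiplicity propagates up the centre**: if the order of `f` is kept at the generic point of the permissible
centre `V(P)`, it is kept at EVERY prime `𝔭 ⊇ P`. [cite: ZariskiSamuel1960, Ch. VIII §1 Thm. 1] -/
theorem iotaOrd_localization_eq_of_le [IsRegularLocalRing S] (P : Ideal S) [P.IsPrime]
    [IsRegularLocalRing (S ⧸ P)] {f : S} (hf0 : f ≠ 0)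
    (heq : iotaOrd (Localization.AtPrime P) (algebraMap S (Localization.AtPrime P) f) = iotaOrd S f)
    (𝔭 : Ideal S) [𝔭.IsPrime] (hle : P ≤ 𝔭) :
    iotaOrd (Localization.AtPrime 𝔭) (algebraMap S (Localization.AtPrime 𝔭) f) = iotaOrd S f := by
  obtain ⟨ν, hν⟩ := Ordinal.lt_omega0.mp (iotaOrd_lt_omega0_of_ne_zero S hf0)
  exact iotaOrd_localization_eq_of_mem_pow 𝔭 hle hν (mem_pow_of_iotaOrd_localization_eq P hν heq)

/-- **(adm) along a permissible centre** (any ring): `f ∈ P^ν` with `2 ≤ ν` lies in `𝔪_{S_Q}²` at every prime `Q ⊇ P`.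
[folklore] -/
theorem adm_of_mem_pow {P : Ideal S} (Q : Ideal S) [Q.IsPrime] (hle : P ≤ Q) {f : S} {ν : ℕ} (hν2 : 2 ≤ ν)
    (hf : f ∈ P ^ ν) :
    algebraMap S (Localization.AtPrime Q) f ∈ maximalIdeal (Localization.AtPrime Q) ^ 2 := by
  have h : f ∈ Q ^ 2 := Ideal.pow_le_pow_right hν2 (Ideal.pow_right_mono hle ν hf)
  rw [← Localization.AtPrime.map_eq_maximalIdeal, ← Ideal.map_pow]
  exact Ideal.mem_map_of_mem _ h

/-- The (strat) «`P ≤ 𝔭 →`» half and (adm), packaged in the shape of `CanonicalGameClause` for `ι = iotaOrd` at a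
permissible centre `P ∋ f` with `f ∈ P^ν`, `ν = ord f ≥ 2`. [OURS · L1 W4.3, kernel] -/
theorem strat_half_and_adm_of_mem_pow [IsRegularLocalRing S] (P : Ideal S) {f : S} {ν : ℕ}
    (hν : iotaOrd S f = ν) (hν2 : 2 ≤ ν) (hf : f ∈ P ^ ν) :
    (∀ (𝔭 : Ideal S) [𝔭.IsPrime], P ≤ 𝔭 →
        iotaOrd (Localization.AtPrime 𝔭) (algebraMap S (Localization.AtPrime 𝔭) f) = iotaOrd S f) ∧
      ∀ (Q : Ideal S) [Q.IsPrime], P ≤ Q →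
        algebraMap S (Localization.AtPrime Q) f ∈ maximalIdeal (Localization.AtPrime Q) ^ 2 :=
  ⟨fun 𝔭 _ hle => iotaOrd_localization_eq_of_mem_pow 𝔭 hle hν hf, fun Q _ hle => adm_of_mem_pow Q hle hν2 hf⟩

/-! ## 3. Height-one equimultiple primes force the monomial type (every Krull dimension) -/

/-- **Core lemma, height-one form (every Krull dimension).**  Let `S` be a regular local ring, `0 ≠ f ∈ 𝔭` for a prime
`𝔭` of HEIGHT ONE, and suppose the order of `f` does not drop at `𝔭`: `iotaOrd (S_𝔭) f = iotaOrd S f`.  Then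
`f = v·gⁿ` with `v` a unit, `g ∈ 𝔪 ∖ 𝔪²`, `n ≥ 1`, and `𝔭 = (g)`.  (UFD: `𝔭 = (q)` for a prime element `q`;
`f = qᵐ h`, `q ∤ h`; `ord_{S_𝔭} f = m` while `ord_𝔪 f = m·ord q + ord h`.)  This is res-type-073's
`IotaOrderStrat.exists_eq_unit_mul_pow_of_iotaOrd_localization_eq` (p509553) with its hypothesis `dim S ≤ 2` — used
there only to force `height 𝔭 = 1` — replaced by that conclusion; proof adapted verbatim otherwise.
[cite: Matsumura1987, Thm. 20.3; ZariskiSamuel1960, Ch. VIII §1 Thm. 1] -/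
theorem exists_eq_unit_mul_pow_of_iotaOrd_localization_eq_of_height_eq_one [IsRegularLocalRing S]
    {f : S} (hf0 : f ≠ 0) (𝔭 : Ideal S) [𝔭.IsPrime] (hf𝔭 : f ∈ 𝔭) (hht : 𝔭.height = 1)
    (heq : iotaOrd (Localization.AtPrime 𝔭) (algebraMap S (Localization.AtPrime 𝔭) f) = iotaOrd S f) :
    ∃ (v g : S) (n : ℕ), IsUnit v ∧ g ∈ maximalIdeal S ∧ g ∉ maximalIdeal S ^ 2 ∧ 0 < n ∧ f = v * g ^ n ∧
      𝔭 = Ideal.span {g} := by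
  classical
  haveI := isDomain_of_isRegularLocalRing S
  haveI : UniqueFactorizationMonoid S := IsRegularLocalRing.uniqueFactorizationMonoid S
  haveI : IsRegularLocalRing (Localization.AtPrime 𝔭) := isRegularLocalRing_localization_atPrime S 𝔭
  -- `𝔭` is a height-one prime, generated by a prime element `q`
  have h𝔭bot : 𝔭 ≠ ⊥ := fun h => hf0 (Ideal.mem_bot.mp (h ▸ hf𝔭))
  obtain ⟨q, hq𝔭, hq⟩ := Ideal.IsPrime.exists_mem_prime_of_ne_bot ‹_› h𝔭bot
  have h𝔭eq : 𝔭 = Ideal.span {q} := Ideal.eq_span_singleton_of_height_eq_one hht hq𝔭 hq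
  have hq𝔪 : q ∈ maximalIdeal S := IsLocalRing.le_maximalIdeal (Ideal.IsPrime.ne_top ‹_›) hq𝔭
  -- factor `f = qᵐ · h` with `q ∤ h`
  obtain ⟨m, h, hndvd, hfac⟩ := WfDvdMonoid.max_power_factor hf0 hq.irreducible
  have hh0 : h ≠ 0 := by
    rintro rfl
    exact hf0 (by rw [hfac, mul_zero])
  have hh𝔭 : h ∉ 𝔭 := fun hh => hndvd (Ideal.mem_span_singleton.mp (h𝔭eq ▸ hh))
  -- the order at `𝔭`: `ord_{S_𝔭}(q) = 1`, `h` a unit, so `ord_{S_𝔭} f = m`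
  have hunit : IsUnit (algebraMap S (Localization.AtPrime 𝔭) h) :=
    IsLocalization.map_units (Localization.AtPrime 𝔭) (⟨h, hh𝔭⟩ : 𝔭.primeCompl)
  have hq1 : adicOrder (algebraMap S (Localization.AtPrime 𝔭) q) = 1 := by
    apply IotaOrderStrat.adicOrder_eq_one_of_not_mem_sq
    · exact (IsLocalization.AtPrime.to_map_mem_maximal_iff (Localization.AtPrime 𝔭) 𝔭 q).mpr hq𝔭
    · intro hmem
      rw [← Localization.AtPrime.map_eq_maximalIdeal, ← Ideal.map_pow,
        IsLocalization.algebraMap_mem_map_algebraMap_iff (M := 𝔭.primeCompl)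
          (S := Localization.AtPrime 𝔭)] at hmem
      obtain ⟨s, hs, hsq⟩ := hmem
      rw [h𝔭eq, Ideal.span_singleton_pow, Ideal.mem_span_singleton] at hsq
      obtain ⟨c, hc⟩ := hsq
      have hsc : s = q * c := by
        apply mul_right_cancel₀ hq.ne_zero
        rw [hc]
        ring
      exact hs (h𝔭eq ▸ Ideal.mem_span_singleton.mpr ⟨c, hsc⟩)
  have hordp : iotaOrd (Localization.AtPrime 𝔭) (algebraMap S (Localization.AtPrime 𝔭) f) = m := by
    rw [hfac, map_mul, map_pow, iotaOrd_eq_ordOfENat_adicOrder, ← ordOfENat_natCast, ordOfENat_inj,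
      adicOrder_mul, adicOrder_pow, hq1, adicOrder_of_isUnit hunit, mul_one, add_zero]
  -- the order at `𝔪`: `ord f = m · ord q + ord h`
  have hord : iotaOrd S f = ordOfENat (m * adicOrder q + adicOrder h) := by
    rw [iotaOrd_eq_ordOfENat_adicOrder, hfac, adicOrder_mul, adicOrder_pow]
  rw [hordp, hord, ← ordOfENat_natCast, ordOfENat_inj] at heq
  obtain ⟨a, ha⟩ := ENat.ne_top_iff_exists.mp (adicOrder_ne_top hq.ne_zero)
  obtain ⟨b, hb⟩ := ENat.ne_top_iff_exists.mp (adicOrder_ne_top hh0)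
  have ha1 : 1 ≤ a := by
    have : ((1 : ℕ) : ℕ∞) ≤ adicOrder q := (le_adicOrder_iff q 1).mpr (by rwa [pow_one])
    rw [← ha] at this
    exact_mod_cast this
  have hm1 : 1 ≤ m := by
    rcases Nat.eq_zero_or_pos m with hm | hm
    · exfalso
      apply hndvd
      have hqf : q ∣ f := Ideal.mem_span_singleton.mp (h𝔭eq ▸ hf𝔭)
      rwa [hfac, hm, pow_zero, one_mul] at hqf
    · exact hm
  rw [← ha, ← hb] at heq
  have heq' : m = m * a + b := by exact_mod_cast heq
  have hma : m ≤ m * a := Nat.le_mul_of_pos_right m ha1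
  have hb0 : b = 0 := by omega
  have hma' : m * a = m := by omega
  have ha' : a = 1 := (mul_eq_left₀ (by omega : m ≠ 0)).mp hma'
  -- conclusion: `q ∉ 𝔪²`, `h` is a unit
  have hq2 : q ∉ maximalIdeal S ^ 2 := by
    rw [← adicOrder_le_iff q 1, ← ha, ha']
  have hhu : IsUnit h := by
    by_contra hnu
    have hh𝔪 : h ∈ maximalIdeal S := (IsLocalRing.mem_maximalIdeal h).mpr (mem_nonunits_iff.mpr hnu)
    have : ((1 : ℕ) : ℕ∞) ≤ adicOrder h := (le_adicOrder_iff h 1).mpr (by rwa [pow_one])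
    rw [← hb, hb0] at this
    exact absurd (by exact_mod_cast this : (1 : ℕ) ≤ 0) (by omega)
  exact ⟨h, q, m, hhu, hq𝔪, hq2, hm1, by rw [hfac, mul_comm], h𝔭eq⟩

/-- **An equimultiple height-one prime forces the MONOMIAL TYPE** ((o24-D) vocabulary `IsMonomialType`), in every
Krull dimension. [cite: Matsumura1987, Thm. 20.3] -/
theorem isMonomialType_of_iotaOrd_localization_eq_of_height_eq_one [IsRegularLocalRing S]
    {f : S} (hf0 : f ≠ 0) (𝔭 : Ideal S) [𝔭.IsPrime] (hf𝔭 : f ∈ 𝔭) (hht : 𝔭.height = 1)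
    (heq : iotaOrd (Localization.AtPrime 𝔭) (algebraMap S (Localization.AtPrime 𝔭) f) = iotaOrd S f) :
    IsMonomialType f := by
  obtain ⟨v, g, n, hv, hg, hg2, -, hf, -⟩ :=
    exists_eq_unit_mul_pow_of_iotaOrd_localization_eq_of_height_eq_one hf0 𝔭 hf𝔭 hht heq
  exact ⟨v, g, n, hv, hg, hg2, hf⟩

/-- **Off the monomial type, equimultiple primes have height `≥ 2`** (every Krull dimension): if `0 ≠ f` is not of
monomial type and the order of `f` is kept at a prime `𝔭 ∋ f`, then `2 ≤ height 𝔭`.  At a position of Krull dimension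
`3` this says: the equal-order locus through the closed point consists of `𝔪` and height-two primes (curve germs) only.
[OURS · L1 W4.3, kernel] -/
theorem two_le_height_of_iotaOrd_localization_eq [IsRegularLocalRing S] {f : S} (hf0 : f ≠ 0)
    (hnm : ¬ IsMonomialType f) (𝔭 : Ideal S) [𝔭.IsPrime] (hf𝔭 : f ∈ 𝔭)
    (heq : iotaOrd (Localization.AtPrime 𝔭) (algebraMap S (Localization.AtPrime 𝔭) f) = iotaOrd S f) :
    2 ≤ 𝔭.height := by
  haveI := isDomain_of_isRegularLocalRing S
  have h0 : 𝔭.height ≠ 0 := by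
    rw [Ne, Ideal.height_eq_zero_iff_eq_bot]
    exact fun h => hf0 (Ideal.mem_bot.mp (h ▸ hf𝔭))
  have h1 : 𝔭.height ≠ 1 := fun hht =>
    hnm (isMonomialType_of_iotaOrd_localization_eq_of_height_eq_one hf0 𝔭 hf𝔭 hht heq)
  -- `h ≠ 0`, `h ≠ 1` in `ℕ∞` ⇒ `2 ≤ h`
  generalize 𝔭.height = h at h0 h1 ⊢
  induction h using ENat.recTopCoe with
  | top => exact le_top
  | coe k =>
    have hk0 : k ≠ 0 := fun e => h0 (by simp [e])
    have hk1 : k ≠ 1 := fun e => h1 (by simp [e])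
    exact_mod_cast (show 2 ≤ k by omega)

end EquimultipleCentre

end Summit.ResolutionOfSingularities.ResolutionOfSingularities.Cruxes.HypersurfaceCentreConstruction.LocalEngine

end
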